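import Summits.CriticalPhenomena.CardyFormulaZ2.Theorems.CardyFlipRussoVoronoiHubFromSmirnovDefs
import Literature.Probability.Percolation.VoronoiCrossing

/-!
# Stub `blackRegion_inter_eq_of_local` of line `moebius-exact-delaunay-dilation-ward`
# (crux `VoronoiHubFromSmirnov`, stmt-CriticalPhenomena-6433)

**Locality of the Voronoi colouring** (the deterministic half of the localisation step of the
line; Bollobás–Riordan, *Percolation* (CUP 2006), Ch. 8, the Lemma-18-type statement "the colour
of a point only depends on the nuclei nearby once every point has a nucleus nearby").

In Poisson–Voronoi percolation a point `z` is black for the nucleus sets `(B, W)` iff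
`infDist z B ≤ infDist z W` (`Literature.Probability.Percolation.blackRegion`).  If every point of
a set `D` has a nucleus (black or white) within distance `< s`, then on `D` the colouring only
depends on the nuclei inside the open `2s`-thickening `T := Metric.thickening (2 * s) D` of `D`:
two pairs of nonempty nucleus sets `(B, W)`, `(B', W')` which agree inside `T` have the same black
region inside `D`.

Proof.  Fix `z ∈ D`; then `ball z (2s) ⊆ T`, so `B` and `B'` (resp. `W` and `W'`) agree inside
`ball z (2s)`.  Key lemma (`brl_infDist_eq`): if two nonempty sets `S`, `S'` agree inside
`ball z r` and `infDist z S < r`, then `infDist z S' = infDist z S` (a point of `S` almost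
realising `infDist z S` lies in the ball, hence in `S'`, so `infDist z S' ≤ infDist z S < r`, and
symmetrically).  Since `infDist z (B ∪ W) < s`, one of `infDist z B`, `infDist z W` is `< s`.
If `infDist z B ≤ infDist z W` then `infDist z B < s < 2s`, so `infDist z B' = infDist z B`, and
either `infDist z W' < 2s`, whence `infDist z W' = infDist z W ≥ infDist z B'`, or
`infDist z W' ≥ 2s > infDist z B'`; so `z` is black for `(B', W')` too.  If
`infDist z W < infDist z B` the same argument with the colours exchanged shows that `z` is black
for neither pair.

No new definitions; Mathlib only (`Metric.infDist_lt_iff`, `Metric.infDist_le_dist_of_mem`,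
`Metric.ball_subset_thickening`).
-/

noncomputable section

namespace Summit.CriticalPhenomena.CardyFormulaZ2.Cruxes.VoronoiHubFromSmirnov.MoebiusExactDelaunayDilationWard

open Set Metric

section PseudoMetric

variable {X : Type*} [PseudoMetricSpace X]

/-- If `S` agrees with `S'` inside `ball z r` (one inclusion) and `infDist z S < r`, then
`infDist z S' ≤ infDist z S`: points of `S` almost realising the infimum lie in the ball. -/
theorem brl_infDist_le_of_inter_ball_subset {S S' : Set X} {z : X} {r : ℝ} (hS : S.Nonempty)
    (h : S ∩ ball z r ⊆ S') (hr : infDist z S < r) : infDist z S' ≤ infDist z S := by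
  refine le_of_not_gt fun hlt => ?_
  obtain ⟨q, hqS, hq⟩ := (infDist_lt_iff hS).1 (lt_min hlt hr)
  have hqS' : q ∈ S' := h ⟨hqS, mem_ball'.2 (hq.trans_le (min_le_right _ _))⟩
  exact (hq.trans_le (min_le_left _ _)).not_ge (infDist_le_dist_of_mem hqS')

/-- **Key lemma.** If two nonempty sets `S`, `S'` agree inside `ball z r` and `infDist z S < r`,
then `infDist z S' = infDist z S`. -/
theorem brl_infDist_eq {S S' : Set X} {z : X} {r : ℝ} (hS : S.Nonempty) (hS' : S'.Nonempty)
    (h₁ : S ∩ ball z r ⊆ S') (h₂ : S' ∩ ball z r ⊆ S) (hr : infDist z S < r) :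
    infDist z S' = infDist z S :=
  have hle : infDist z S' ≤ infDist z S := brl_infDist_le_of_inter_ball_subset hS h₁ hr
  le_antisymm hle (brl_infDist_le_of_inter_ball_subset hS' h₂ (hle.trans_lt hr))

/-- **Pointwise locality of the colouring.** If `(B, W)` and `(B', W')` (all nonempty) agree
inside `ball z (2 * s)` and `z` has a nucleus of `B ∪ W` within distance `< s`, then `z` is black
for `(B, W)` iff it is black for `(B', W')`. -/
theorem brl_black_iff {B W B' W' : Set X} {z : X} {s : ℝ} (hB : B.Nonempty) (hW : W.Nonempty)
    (hB' : B'.Nonempty) (hW' : W'.Nonempty)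
    (hBB'₁ : B ∩ ball z (2 * s) ⊆ B') (hBB'₂ : B' ∩ ball z (2 * s) ⊆ B)
    (hWW'₁ : W ∩ ball z (2 * s) ⊆ W') (hWW'₂ : W' ∩ ball z (2 * s) ⊆ W)
    (hz : infDist z (B ∪ W) < s) :
    (infDist z B ≤ infDist z W ↔ infDist z B' ≤ infDist z W') := by
  have hs : 0 < s := infDist_nonneg.trans_lt hz
  have hs2 : s < 2 * s := by linarith
  obtain ⟨q, hq, hzq⟩ := (infDist_lt_iff (hB.mono subset_union_left)).1 hz
  rcases le_or_gt (infDist z B) (infDist z W) with hle | hlt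
  · -- `z` is black for `(B, W)`; show it is black for `(B', W')`.
    have hBs : infDist z B < s := by
      rcases hq with hqB | hqW
      · exact (infDist_le_dist_of_mem hqB).trans_lt hzq
      · exact hle.trans_lt ((infDist_le_dist_of_mem hqW).trans_lt hzq)
    have hBeq : infDist z B' = infDist z B := brl_infDist_eq hB hB' hBB'₁ hBB'₂ (hBs.trans hs2)
    refine iff_of_true hle ?_
    rcases lt_or_ge (infDist z W') (2 * s) with hW's | hW's
    · have hWeq : infDist z W = infDist z W' := brl_infDist_eq hW' hW hWW'₂ hWW'₁ hW's
      rw [hBeq, ← hWeq]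
      exact hle
    · rw [hBeq]
      exact ((hBs.trans hs2).trans_le hW's).le
  · -- `z` is not black for `(B, W)`; show it is not black for `(B', W')`.
    have hWs : infDist z W < s := by
      rcases hq with hqB | hqW
      · exact hlt.trans ((infDist_le_dist_of_mem hqB).trans_lt hzq)
      · exact (infDist_le_dist_of_mem hqW).trans_lt hzq
    have hWeq : infDist z W' = infDist z W := brl_infDist_eq hW hW' hWW'₁ hWW'₂ (hWs.trans hs2)
    refine iff_of_false (not_le.2 hlt) (not_le.2 ?_)
    rcases lt_or_ge (infDist z B') (2 * s) with hB's | hB's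
    · have hBeq : infDist z B = infDist z B' := brl_infDist_eq hB' hB hBB'₂ hBB'₁ hB's
      rw [hWeq, ← hBeq]
      exact hlt
    · rw [hWeq]
      exact (hWs.trans hs2).trans_le hB's

end PseudoMetric

/-- Sets agreeing inside `T` agree inside any `U ⊆ T` (one inclusion). -/
theorem brl_inter_subset_of_inter_eq {α : Type*} {S S' T U : Set α} (h : S ∩ T = S' ∩ T)
    (hU : U ⊆ T) : S ∩ U ⊆ S' :=
  fun q hq => ((Set.ext_iff.1 h q).1 ⟨hq.1, hU hq.2⟩).1

/-- **Locality of the Voronoi colouring** (Bollobás–Riordan 2006, Ch. 8): if every point of `D`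
has a nucleus of `B ∪ W` within distance `< s`, and the nonempty nucleus pairs `(B, W)`, `(B', W')`
agree inside the open `2s`-thickening of `D`, then their black regions agree inside `D`. -/
theorem blackRegion_inter_eq_of_local :
    ∀ (B W B' W' D : Set ℂ) (s : ℝ), B.Nonempty → W.Nonempty → B'.Nonempty → W'.Nonempty →
    B ∩ Metric.thickening (2 * s) D = B' ∩ Metric.thickening (2 * s) D →
    W ∩ Metric.thickening (2 * s) D = W' ∩ Metric.thickening (2 * s) D →
    (∀ z ∈ D, Metric.infDist z (B ∪ W) < s) →
    Literature.Probability.Percolation.blackRegion B W ∩ D =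
      Literature.Probability.Percolation.blackRegion B' W' ∩ D := by
  intro B W B' W' D s hB hW hB' hW' hBB' hWW' hD
  refine Set.ext fun z => and_congr_left fun hzD => ?_
  have hU : ball z (2 * s) ⊆ thickening (2 * s) D := ball_subset_thickening hzD (2 * s)
  exact brl_black_iff hB hW hB' hW' (brl_inter_subset_of_inter_eq hBB' hU)
    (brl_inter_subset_of_inter_eq hBB'.symm hU) (brl_inter_subset_of_inter_eq hWW' hU)
    (brl_inter_subset_of_inter_eq hWW'.symm hU) (hD z hzD)

end Summit.CriticalPhenomena.CardyFormulaZ2.Cruxes.VoronoiHubFromSmirnov.MoebiusExactDelaunayDilationWard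

end
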